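import Summits.Ventures.LatticeQCDFlow.Exactness.Phi4HMCFluctuationRelation
import Mathlib.Analysis.SpecialFunctions.Trigonometric.DerivHyp
import HarnessLib

/-!
HONEST FRAMING: exact (Metropolis-corrected) sampling algorithms for lattice gauge theory; figures
of merit are autocorrelation/cost numbers at stated couplings and volumes; no continuum-physics
claim.

# AcceptanceFromMeanEnergyViolationTwoState — THE TWO-STATE METROPOLIS FLIP IS THE EXTREMAL REVERSIBLE
# PROPOSAL: WITH ENERGY GAP `a` IT HAS `⟨ΔH⟩ = a·tanh(a/2)` AND ACCEPTANCE `2/(1 + e^{a}) = 1 − tanh(a/2)`,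
# I.E. IT SITS ON THE PENCIL `1 − ⟨P_acc⟩ = (cosh a − 1 + ⟨ΔH⟩)/(a + sinh a)` OF
# `AcceptanceFromMeanEnergyViolationSharp` WITH EQUALITY (row 22 `su3-ptbc`, GEN-10, ours)

Venture `LatticeQCDFlow` (cell pub-lqcd), topic `Exactness`; FANOUT row 22 (`su3-ptbc`).  NEW WORK of the cell in
row 2's framework `Exactness/Phi4HMCFluctuationRelation` (`deltaH H Ψ = H∘Ψ − H`) over Mathlib (`Measure.dirac`,
`integral_dirac`, `Measure.map_dirac`).  Nothing is cited as a fact; no numerics.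

THE POINT.  `AcceptanceFromMeanEnergyViolationSharp` (this seat, filed alongside) proves for every measurable
`μ`-preserving involution `Ψ`, weight `e^{−H}`, `Z = ∫ e^{−H}`, `A = ∫ min(1, e^{−ΔH}) e^{−H}`,
`m = Z⁻¹ ∫ ΔH e^{−H}`, and every `a > 0`:  `(1 − (cosh a − 1 + m)/(a + sinh a))·Z ≤ A`.  This file types the
WITNESS that the pencil cannot be improved: the smallest reversible system — two states `false, true` with
energies `0, a`, reference measure `δ_false + δ_true`, proposal `Ψ = not` (a measure-preserving involution) —
has `Z = 1 + e^{−a}`, `∫ ΔH e^{−H} = a(1 − e^{−a})`, `A = 2e^{−a}`, hence `m = a(1 − e^{−a})/(1 + e^{−a}) = a tanh(a/2)`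
and `A/Z = 2e^{−a}/(1 + e^{−a}) = 1 − tanh(a/2)`, and the pencil member with parameter `a` holds with EQUALITY:
`(1 − (cosh a − 1 + m)/(a + sinh a))·Z = A`.  Every floor of the acceptance in terms of `⟨ΔH⟩` alone that is
valid for all volume-preserving reversible proposals (row 2's Bretagnolle–Huber and Pinsker floors
`AcceptanceFromMeanEnergyViolation{,Pinsker}` included) is therefore at most `1 − tanh(a/2)` at `m = a tanh(a/2)`;
the pencil's envelope is exactly that curve.  (A Metropolis single-spin flip of an isolated Ising spin in a
field, or the swap of two replicas whose tempered statistic takes two values, realises this system.)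

## What is proved (`a : ℝ`; `μ₂ = Measure.dirac false + Measure.dirac true` on `Bool`; `H_a b = if b then a
else 0`; `Ψ = not`)

* §1 `integral_diracPair_bool` (`∫ g dμ₂ = g false + g true`), `measurePreserving_not_twoPoint`, `bool_not_involutive`,
  `deltaH_twoState_false/true` (`ΔH = a` at `false`, `−a` at `true`).
* §2 the three integrals: **`twoState_partition`** (`Z = 1 + e^{−a}`), **`twoState_meanViolation`**
  (`∫ ΔH e^{−H} = a(1 − e^{−a})`), **`twoState_acceptance`** (`a ≥ 0`: `A = 2e^{−a}`).
* §3 `cosh_sub_one_eq_halfTanh_mul_sinh` (`cosh a − 1 = ((1 − e^{−a})/(1 + e^{−a}))·sinh a`),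
  `coshPencil_at_twoState` (`a > 0`: `(cosh a − 1 + a·t)/(a + sinh a) = t`, `t = (1 − e^{−a})/(1 + e^{−a})`), and
  **`twoState_attains_coshPencil`** (`a > 0`):
  `(1 − (cosh a − 1 + (∫ ΔH e^{−H})/Z)/(a + sinh a)) · Z = ∫ min(1, e^{−ΔH}) e^{−H}` for the two-state flip —
  EQUALITY in `involutive_acceptance_ge_cosh`.

Literature grade (cell rule): the two-level Metropolis rate `min(1, e^{−a})` is textbook; its role as the
extremiser of the acceptance-vs-`⟨ΔH⟩` problem for reversible volume-preserving proposals — NEW TYPING (with the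
pencil).  NOT CLAIMED: uniqueness of the extremiser; anything about a run.
-/

namespace Summit.Ventures.LatticeQCDFlow.Exactness

open Real MeasureTheory

/-! ## §1 The two-point reference measure and the flip -/

section TwoPoint

/-- `∫ g d(δ_false + δ_true) = g false + g true`. [folklore] -/
theorem integral_diracPair_bool (g : Bool → ℝ) :
    ∫ b, g b ∂(Measure.dirac false + Measure.dirac true) = g false + g true := by
  rw [integral_add_measure Integrable.of_finite Integrable.of_finite, integral_dirac, integral_dirac]

/-- The flip `not` preserves `δ_false + δ_true`. [folklore] -/
theorem measurePreserving_not_twoPoint :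
    MeasurePreserving not (Measure.dirac false + Measure.dirac true)
      (Measure.dirac false + Measure.dirac true) := by
  refine ⟨measurable_of_countable _, ?_⟩
  rw [Measure.map_add _ _ (measurable_of_countable _), Measure.map_dirac, Measure.map_dirac, Bool.not_false,
    Bool.not_true, add_comm]

/-- `not` is an involution. [folklore] -/
theorem bool_not_involutive : Function.Involutive not := Bool.not_not

/-- At `false` the flip raises the energy by `a`: `ΔH(false) = a`. [ours] -/
theorem deltaH_twoState_false (a : ℝ) : deltaH (fun b : Bool => if b then a else 0) not false = a := by
  simp [deltaH]

/-- At `true` the flip lowers the energy by `a`: `ΔH(true) = −a`. [ours] -/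
theorem deltaH_twoState_true (a : ℝ) : deltaH (fun b : Bool => if b then a else 0) not true = -a := by
  simp [deltaH]

end TwoPoint

/-! ## §2 The three equilibrium integrals of the two-state flip -/

section Integrals

/-- **`Z = 1 + e^{−a}`.** [ours] -/
theorem twoState_partition (a : ℝ) :
    ∫ b, Real.exp (-(fun b : Bool => if b then a else 0) b) ∂(Measure.dirac false + Measure.dirac true)
      = 1 + Real.exp (-a) := by
  rw [integral_diracPair_bool]
  simp

/-- **`∫ ΔH e^{−H} = a(1 − e^{−a})`.** [ours] -/
theorem twoState_meanViolation (a : ℝ) :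
    ∫ b, deltaH (fun b : Bool => if b then a else 0) not b * Real.exp (-(fun b : Bool => if b then a else 0) b)
        ∂(Measure.dirac false + Measure.dirac true)
      = a * (1 - Real.exp (-a)) := by
  rw [integral_diracPair_bool, deltaH_twoState_false, deltaH_twoState_true]
  simp only [Bool.false_eq_true, ↓reduceIte, neg_zero, Real.exp_zero, mul_one]
  ring

/-- **`A = ∫ min(1, e^{−ΔH}) e^{−H} = 2e^{−a}`** for `a ≥ 0` (uphill `e^{−a}·1`, downhill `1·e^{−a}`). [ours] -/
theorem twoState_acceptance {a : ℝ} (ha : 0 ≤ a) :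
    ∫ b, min 1 (Real.exp (-deltaH (fun b : Bool => if b then a else 0) not b))
        * Real.exp (-(fun b : Bool => if b then a else 0) b) ∂(Measure.dirac false + Measure.dirac true)
      = 2 * Real.exp (-a) := by
  rw [integral_diracPair_bool, deltaH_twoState_false, deltaH_twoState_true]
  simp only [Bool.false_eq_true, ↓reduceIte, neg_zero, Real.exp_zero, mul_one, neg_neg]
  have h1 : Real.exp (-a) ≤ 1 := by rw [← Real.exp_zero]; exact Real.exp_le_exp.mpr (by linarith)
  have h2 : (1 : ℝ) ≤ Real.exp a := by rw [← Real.exp_zero]; exact Real.exp_le_exp.mpr ha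
  rw [min_eq_right h1, min_eq_left h2]
  ring

end Integrals

/-! ## §3 Equality in the pencil -/

section Attainment

/-- `cosh a − 1 = t · sinh a` with `t = (1 − e^{−a})/(1 + e^{−a})` (`= tanh(a/2)`). [folklore] -/
theorem cosh_sub_one_eq_halfTanh_mul_sinh (a : ℝ) :
    Real.cosh a - 1 = (1 - Real.exp (-a)) / (1 + Real.exp (-a)) * Real.sinh a := by
  rw [Real.cosh_eq, Real.sinh_eq]
  have hv : 0 < Real.exp (-a) := Real.exp_pos _
  have huv : Real.exp a * Real.exp (-a) = 1 := by rw [← Real.exp_add, add_neg_cancel, Real.exp_zero]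
  have hne : 1 + Real.exp (-a) ≠ 0 := by linarith
  field_simp
  nlinarith [huv]

/-- **The pencil member with parameter `a` evaluated at the two-state mean**: for `a > 0` and
`t = (1 − e^{−a})/(1 + e^{−a})`, `(cosh a − 1 + a·t)/(a + sinh a) = t`. [ours] -/
theorem coshPencil_at_twoState {a : ℝ} (ha : 0 < a) :
    (Real.cosh a - 1 + a * ((1 - Real.exp (-a)) / (1 + Real.exp (-a)))) / (a + Real.sinh a)
      = (1 - Real.exp (-a)) / (1 + Real.exp (-a)) := by
  have hc : 0 < a + Real.sinh a := add_pos ha (Real.sinh_pos_iff.mpr ha)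
  rw [cosh_sub_one_eq_halfTanh_mul_sinh a, div_eq_iff hc.ne']
  ring

/-- **THE TWO-STATE FLIP ATTAINS THE PENCIL**: for `a > 0`, with `μ₂ = δ_false + δ_true`, `H_a b = if b then a
else 0`, `Ψ = not`:
`(1 − (cosh a − 1 + (∫ ΔH e^{−H} dμ₂)/(∫ e^{−H} dμ₂))/(a + sinh a)) · ∫ e^{−H} dμ₂ = ∫ min(1, e^{−ΔH}) e^{−H} dμ₂`
— equality in `involutive_acceptance_ge_cosh` at parameter `a` (mean `a tanh(a/2)`, acceptance
`2/(1 + e^{a})`). [ours] -/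
theorem twoState_attains_coshPencil {a : ℝ} (ha : 0 < a) :
    (1 - (Real.cosh a - 1
        + (∫ b, deltaH (fun b : Bool => if b then a else 0) not b
              * Real.exp (-(fun b : Bool => if b then a else 0) b) ∂(Measure.dirac false + Measure.dirac true))
          / ∫ b, Real.exp (-(fun b : Bool => if b then a else 0) b) ∂(Measure.dirac false + Measure.dirac true))
        / (a + Real.sinh a))
      * ∫ b, Real.exp (-(fun b : Bool => if b then a else 0) b) ∂(Measure.dirac false + Measure.dirac true)
      = ∫ b, min 1 (Real.exp (-deltaH (fun b : Bool => if b then a else 0) not b))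
          * Real.exp (-(fun b : Bool => if b then a else 0) b) ∂(Measure.dirac false + Measure.dirac true) := by
  rw [twoState_meanViolation, twoState_partition, twoState_acceptance ha.le]
  have hv : 0 < Real.exp (-a) := Real.exp_pos _
  have hZ : (1 + Real.exp (-a)) ≠ 0 := by linarith
  have e1 : a * (1 - Real.exp (-a)) / (1 + Real.exp (-a)) = a * ((1 - Real.exp (-a)) / (1 + Real.exp (-a))) := by
    ring
  rw [e1, coshPencil_at_twoState ha]
  field_simp
  ring

/-- **The two-state numbers in closed form**: for `a > 0` the mean violation per unit mass is
`a(1 − e^{−a})/(1 + e^{−a})` and the acceptance per unit mass is `2e^{−a}/(1 + e^{−a})`, and they satisfy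
`acceptance = 1 − (cosh a − 1 + mean)/(a + sinh a)` exactly. [ours] -/
theorem twoState_rate_eq_pencil {a : ℝ} (ha : 0 < a) :
    2 * Real.exp (-a) / (1 + Real.exp (-a))
      = 1 - (Real.cosh a - 1 + a * (1 - Real.exp (-a)) / (1 + Real.exp (-a))) / (a + Real.sinh a) := by
  have hv : 0 < Real.exp (-a) := Real.exp_pos _
  have hZ : (1 + Real.exp (-a)) ≠ 0 := by linarith
  have e1 : a * (1 - Real.exp (-a)) / (1 + Real.exp (-a)) = a * ((1 - Real.exp (-a)) / (1 + Real.exp (-a))) := by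
    ring
  rw [e1, coshPencil_at_twoState ha]
  field_simp
  ring

end Attainment

end Summit.Ventures.LatticeQCDFlow.Exactness
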